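import Literature.MathematicalPhysics.QuantumManyBody.JelliumBoxExcitationBound
import HarnessLib

/-!
# The condensate projections `P_j`, `Q_j = 1 - P_j` of an `n`-body function (first-quantized `n̂₀`, `n̂₊`)

Topic `Literature/MathematicalPhysics/QuantumManyBody` (the charged Bose gas, `JelliumBoseGas.foldyLaw`).
[LiebSolovej2001, §5] writes the one-box Hamiltonian `H^n_{ℓ,r,R}` in second quantization over the
Neumann basis `u_p` and organizes the estimates of §5–§8 by the number of indices `p = 0`
(the condensate `u_0 = ℓ^{-3/2}`) in the coefficients `ŵ_{pq,μν}`; `n̂₀ = a*₀a₀`, `n̂₊ = ∑_{p≠0}a*_pa_p`.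
In first quantization this is the decomposition of each variable by the projection `P` onto the
constants of `L²(Λ)` and `Q = 1 - P`: `n̂₀ = ∑ⱼ Pⱼ`, `n̂₊ = ∑ⱼ Qⱼ`. This file sets up `Pⱼ`, `Qⱼ` on
functions `Ψ : Λ^n → ℂ` in the slice form of the tree (`depletion`, `condensateOccupation`,
`NeumannMomentumCutoffs`), as step (1) of the first-quantized route to [LiebSolovej2001, Thm. 9.2]:

* `JelliumBoseGas.sliceMean ℓ j Ψ X = ⨍_{y∈Λ} Ψ(X; xⱼ ↦ y)` (`PⱼΨ`) and
  `sliceFluct ℓ j Ψ = Ψ - PⱼΨ` (`QⱼΨ`);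
* `sliceMean_update` (`PⱼΨ` does not depend on `xⱼ`), `setIntegral_cell_sliceFluct`
  (`∫_Λ QⱼΨ dxⱼ = 0`), `lintegral_cell_normSq_eq` (Pythagoras
  `∫_Λ|Ψ|²dxⱼ = ∫_Λ|QⱼΨ|²dxⱼ + ∫_Λ|PⱼΨ|²dxⱼ`);
* `depletion_eq_sum_sliceFluct` — `⟨Ψ, n̂₊Ψ⟩ = ∑ⱼ ℓ⁻³∫_{Λ^n}∫_Λ |QⱼΨ|²`;
* `sum_lintegral_mul_normSq_sliceFluct_le` — the shape of [LiebSolovej2001, Lemma 5.3]: a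
  multiplication operator `0 ≤ m ≤ M < ∞` sandwiched between `Qⱼ`'s is bounded by `M n̂₊` in
  expectation: `∑ⱼ ℓ⁻³∫∫ m(xⱼ)|QⱼΨ|² ≤ M ⟨Ψ, n̂₊Ψ⟩`.

## References

* [LiebSolovej2001] E. H. Lieb, J. P. Solovej, Commun. Math. Phys. 217 (2001) 127–163, §5
  (the operators `n̂₀`, `n̂₊`; Lemma 5.3) (arXiv:cond-mat/0007425, p. 11).
* [LSSY2005] E. H. Lieb, R. Seiringer, J. P. Solovej, J. Yngvason, *The Mathematics of the Bose
  Gas and its Condensation*, Birkhäuser 2005, Ch. 5 (5.17) (the variance identity).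
-/

noncomputable section

open MeasureTheory Set Filter Real
open scoped ENNReal NNReal Topology

namespace Literature.MathematicalPhysics.QuantumManyBody.JelliumBoseGas

open BoseGas
open Literature.Barriers.AtomisticToContinuum.BoseGas (depletion lintegral_nnnorm_sq_cell_eq
  inv_ofReal_pow_three)

variable {n : ℕ}

/-! ### Definitions -/

/-- **`PⱼΨ`**: the average of `Ψ` over the `j`-th variable in the box `Λ_ℓ`,
`(PⱼΨ)(X) = ℓ⁻³∫_Λ Ψ(X; xⱼ ↦ y) dy` (the projection onto the condensate `u_0 = ℓ^{-3/2}` in the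
`j`-th variable; `n̂₀ = ∑ⱼPⱼ`). [cite: LiebSolovej2001, §5] -/
def sliceMean (ℓ : ℝ) (j : Fin n) (Ψ : Config n → ℂ) (X : Config n) : ℂ :=
  ⨍ y in cell ℓ, Ψ (Function.update X j y)

/-- **`QⱼΨ = Ψ - PⱼΨ`** (the projection off the condensate in the `j`-th variable;
`n̂₊ = ∑ⱼQⱼ`). [cite: LiebSolovej2001, §5] -/
def sliceFluct (ℓ : ℝ) (j : Fin n) (Ψ : Config n → ℂ) (X : Config n) : ℂ :=
  Ψ X - sliceMean ℓ j Ψ X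

/-! ### Algebra -/

section Algebra

variable (ℓ : ℝ) (j : Fin n) (Ψ : Config n → ℂ)

/-- `PⱼΨ` does not depend on `xⱼ`. [folklore] -/
theorem sliceMean_update (X : Config n) (y : Space) :
    sliceMean ℓ j Ψ (Function.update X j y) = sliceMean ℓ j Ψ X := by
  simp [sliceMean, Function.update_idem]

/-- `QⱼΨ` on the `j`-th fibre. [folklore] -/
theorem sliceFluct_update (X : Config n) (y : Space) :
    sliceFluct ℓ j Ψ (Function.update X j y) = Ψ (Function.update X j y) - sliceMean ℓ j Ψ X := by
  rw [sliceFluct, sliceMean_update]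

/-- `Ψ = PⱼΨ + QⱼΨ`. [folklore] -/
theorem sliceMean_add_sliceFluct (X : Config n) : sliceMean ℓ j Ψ X + sliceFluct ℓ j Ψ X = Ψ X := by
  rw [sliceFluct]; ring

/-- `Pⱼ` is idempotent: `Pⱼ(PⱼΨ) = PⱼΨ` (`ℓ > 0`). [folklore] -/
theorem sliceMean_sliceMean {ℓ : ℝ} (hℓ : 0 < ℓ) (j : Fin n) (Ψ : Config n → ℂ) (X : Config n) :
    sliceMean ℓ j (sliceMean ℓ j Ψ) X = sliceMean ℓ j Ψ X := by
  unfold sliceMean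
  simp_rw [Function.update_idem]
  haveI : IsFiniteMeasure (volume.restrict (cell ℓ)) :=
    isFiniteMeasure_restrict.2 (by rw [volume_cell]; exact ENNReal.pow_ne_top ENNReal.ofReal_ne_top)
  have h0 : volume (cell ℓ) ≠ 0 := by
    rw [volume_cell]; exact pow_ne_zero _ (by simpa using hℓ)
  rw [setAverage_const h0 (by rw [volume_cell]; exact ENNReal.pow_ne_top ENNReal.ofReal_ne_top)]

end Algebra

/-! ### Orthogonality and Pythagoras on a fibre -/

section Fibre

variable {ℓ : ℝ}

/-- **`∫_Λ QⱼΨ dxⱼ = 0`** for continuous `Ψ` (`ℓ > 0`). [cite: LiebSolovej2001, §5] -/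
theorem setIntegral_cell_sliceFluct (hℓ : 0 < ℓ) (j : Fin n) {Ψ : Config n → ℂ}
    (hΨ : Continuous Ψ) (X : Config n) :
    ∫ y in cell ℓ, sliceFluct ℓ j Ψ (Function.update X j y) = 0 := by
  simp_rw [sliceFluct_update]
  have hcont : Continuous fun y : Space => Ψ (Function.update X j y) :=
    hΨ.comp (continuous_const.update j continuous_id)
  have hint : IntegrableOn (fun y : Space => Ψ (Function.update X j y)) (cell ℓ) := integrableOn_cell hcont
  haveI : IsFiniteMeasure (volume.restrict (cell ℓ)) :=
    isFiniteMeasure_restrict.2 (by rw [volume_cell]; exact ENNReal.pow_ne_top ENNReal.ofReal_ne_top)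
  rw [integral_sub hint (integrable_const _), setIntegral_const, sliceMean, setAverage_eq, smul_smul,
    mul_inv_cancel₀ ?_, one_smul, sub_self]
  rw [measureReal_def, volume_cell, ENNReal.toReal_pow, ENNReal.toReal_ofReal hℓ.le]
  positivity

/-- **Pythagoras on a fibre**: `∫_Λ |Ψ|² dxⱼ = ∫_Λ |QⱼΨ|² dxⱼ + ∫_Λ |PⱼΨ|² dxⱼ` for continuous `Ψ`
(`ℓ > 0`); the last term is `ℓ³|PⱼΨ(X)|²`. [cite: LSSY2005, Ch. 5 (5.17)] -/
theorem lintegral_cell_normSq_eq (hℓ : 0 < ℓ) (j : Fin n) {Ψ : Config n → ℂ}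
    (hΨ : Continuous Ψ) (X : Config n) :
    ∫⁻ y in cell ℓ, (‖Ψ (Function.update X j y)‖₊ : ℝ≥0∞) ^ 2 =
      (∫⁻ y in cell ℓ, (‖sliceFluct ℓ j Ψ (Function.update X j y)‖₊ : ℝ≥0∞) ^ 2) +
        ENNReal.ofReal ℓ ^ 3 * (‖sliceMean ℓ j Ψ X‖₊ : ℝ≥0∞) ^ 2 := by
  have hcont : Continuous fun y : Space => Ψ (Function.update X j y) :=
    hΨ.comp (continuous_const.update j continuous_id)
  rw [lintegral_nnnorm_sq_cell_eq hℓ hcont]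
  simp_rw [sliceFluct_update]
  congr 1
  -- `(ofReal ℓ ^ 3)⁻¹ ‖∫Ψ‖² = ofReal ℓ ^ 3 ‖⨍Ψ‖²`
  rw [sliceMean, setAverage_eq, measureReal_def, volume_cell, ENNReal.toReal_pow,
    ENNReal.toReal_ofReal hℓ.le, ← ofReal_norm_sq_eq, ← ofReal_norm_sq_eq, inv_ofReal_pow_three hℓ,
    ← ENNReal.ofReal_pow hℓ.le, ← ENNReal.ofReal_mul (by positivity),
    ← ENNReal.ofReal_mul (by positivity)]
  congr 1
  rw [norm_smul, Real.norm_eq_abs, abs_of_pos (by positivity)]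
  field_simp

end Fibre

/-! ### `n̂₊` and multiplication operators between `Qⱼ`'s -/

section NPlus

variable {ℓ : ℝ}

/-- **`⟨Ψ, n̂₊Ψ⟩ = ∑ⱼ ℓ⁻³ ∫_{Λ^n}∫_Λ |QⱼΨ|²`**: the depletion functional of the tree is the
expectation of `n̂₊ = ∑ⱼ Qⱼ`. [cite: LiebSolovej2001, §5] -/
theorem depletion_eq_sum_sliceFluct (ℓ : ℝ) (Ψ : Config n → ℂ) :
    depletion n ℓ Ψ = ∑ j : Fin n, (ENNReal.ofReal ℓ ^ 3)⁻¹ *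
      ∫⁻ X in cellN n ℓ, ∫⁻ x in cell ℓ, (‖sliceFluct ℓ j Ψ (Function.update X j x)‖₊ : ℝ≥0∞) ^ 2 := by
  unfold depletion
  simp_rw [sliceFluct_update, sliceMean]

/-- **A multiplication operator between `Qⱼ`'s is bounded by `n̂₊`** (the shape of
[LiebSolovej2001, Lemma 5.3]: `0 ≤ ∑_{p,q≠0} m̂_{pq} a*_p a_q ≤ (sup m) n̂₊` for `0 ≤ m ≤ M`):
`∑ⱼ ℓ⁻³∫_{Λ^n}∫_Λ m(xⱼ)|QⱼΨ|² ≤ M ⟨Ψ, n̂₊Ψ⟩`. [cite: LiebSolovej2001, Lemma 5.3] -/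
theorem sum_lintegral_mul_normSq_sliceFluct_le (ℓ : ℝ) (Ψ : Config n → ℂ) {m : Space → ℝ≥0∞}
    {M : ℝ≥0∞} (hM : M ≠ ⊤) (hm : ∀ x, m x ≤ M) :
    ∑ j : Fin n, (ENNReal.ofReal ℓ ^ 3)⁻¹ * ∫⁻ X in cellN n ℓ, ∫⁻ x in cell ℓ,
        m x * (‖sliceFluct ℓ j Ψ (Function.update X j x)‖₊ : ℝ≥0∞) ^ 2 ≤
      M * depletion n ℓ Ψ := by
  rw [depletion_eq_sum_sliceFluct, Finset.mul_sum]
  refine Finset.sum_le_sum fun j _ => ?_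
  have hin : ∫⁻ X in cellN n ℓ, ∫⁻ x in cell ℓ, m x * (‖sliceFluct ℓ j Ψ (Function.update X j x)‖₊ : ℝ≥0∞) ^ 2 ≤
      M * ∫⁻ X in cellN n ℓ, ∫⁻ x in cell ℓ, (‖sliceFluct ℓ j Ψ (Function.update X j x)‖₊ : ℝ≥0∞) ^ 2 := by
    calc ∫⁻ X in cellN n ℓ, ∫⁻ x in cell ℓ, m x * (‖sliceFluct ℓ j Ψ (Function.update X j x)‖₊ : ℝ≥0∞) ^ 2
        ≤ ∫⁻ X in cellN n ℓ, ∫⁻ x in cell ℓ, M * (‖sliceFluct ℓ j Ψ (Function.update X j x)‖₊ : ℝ≥0∞) ^ 2 :=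
          lintegral_mono fun X => lintegral_mono fun x => by gcongr; exact hm x
      _ = M * ∫⁻ X in cellN n ℓ, ∫⁻ x in cell ℓ, (‖sliceFluct ℓ j Ψ (Function.update X j x)‖₊ : ℝ≥0∞) ^ 2 := by
          simp_rw [lintegral_const_mul' M _ hM]
  calc (ENNReal.ofReal ℓ ^ 3)⁻¹ * ∫⁻ X in cellN n ℓ, ∫⁻ x in cell ℓ,
        m x * (‖sliceFluct ℓ j Ψ (Function.update X j x)‖₊ : ℝ≥0∞) ^ 2
      ≤ (ENNReal.ofReal ℓ ^ 3)⁻¹ * (M * ∫⁻ X in cellN n ℓ, ∫⁻ x in cell ℓ,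
          (‖sliceFluct ℓ j Ψ (Function.update X j x)‖₊ : ℝ≥0∞) ^ 2) := by gcongr
    _ = M * ((ENNReal.ofReal ℓ ^ 3)⁻¹ * ∫⁻ X in cellN n ℓ, ∫⁻ x in cell ℓ,
          (‖sliceFluct ℓ j Ψ (Function.update X j x)‖₊ : ℝ≥0∞) ^ 2) := by ring

end NPlus

end Literature.MathematicalPhysics.QuantumManyBody.JelliumBoseGas
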